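import Summits.QuantumFields.YangMills.Theses.ScalingWindowSplit

/-!
# Sketch — crux-ideate r1 i1 on `SelfNormalisedMomentBoundsR` (stmt-QuantumFields-18014)

First lemmas of the two idea cards of ideator 1 (planner-cruxidea-stmt-QuantumFields-18014-1-0),
stated over existing declarations; no proofs (definitions only, nothing to `sorry`).

* Card `scale-ladder-free-foot`: `PlaquetteChiSqDomination` (χ²-domination of Wilson plaquette
  energies from temporal-gauge Gaussian domination + axis symmetry — the hub card
  gaussian-domination-glue-twist-residue (C1) in exponential-moment form) and its consequence
  `LatticeScaleMoments` (k-uniform `n!`-type moment bounds of centred plaquette energies in units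
  of `1/β`, all plaquette tuples, all tori — the FOOT of the scale ladder: at lattice-scale rulers
  the self-normalised curvature field has all moments).
* Card `polynomial-coupling-calibration`: `SelfNormalisedMomentBoundsPoly θ` — the crux's own body
  (character-identical) under ONE extra scheme hypothesis, `L_k ^ θ ≤ β_k` eventually (polynomially
  super-weak coupling); the top rung of the coupling-vs-volume ladder.
-/

namespace Summit.QuantumFields.YangMills.Cruxes.SelfNormalisedMomentBoundsR.Ideator1

open scoped BigOperators Topology
open Filter MeasureTheory
open Literature.MathematicalPhysics.QuantumLattice Literature.MathematicalPhysics.AQFT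
  Literature.MathematicalPhysics.QuantumFieldTheory

/-- **χ²-domination of plaquette energies** (card `scale-ladder-free-foot`, First lemma). For every
compact `G`, faithful unitary lattice representation `r` (dimension `N = r.N`), every torus side,
every `β > 0`, every plaquette and every `0 ≤ t < 1`:
`E_{β} exp(t·β·(N − Re tr ρ(U_p))) ≤ (1 − t)^{−N²}`.
Sketch of proof: temporal gauge turns the time-like plaquette terms of `exp(−β S)` into the
Fröhlich–Simon–Spencer kinetic form `exp(−(β/2)‖U_e(t+1) − U_e(t)‖²_HS)` with an arbitrary
(Haar × space-like plaquette) single-slice measure; bond-reflection positivity + the FSS extremal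
argument give Gaussian domination `E exp(β Re⟨h, ∇ₜU⟩) ≤ exp((β/2)‖h‖²)` for all matrix fields `h`;
Hubbard–Stratonovich over a Gaussian `h` supported on one bond block (`dim_ℝ M_N(ℂ) = 2N²`) gives
the display for time-like plaquettes, and the axis symmetry of the torus measure for all. -/
def PlaquetteChiSqDomination : Prop :=
  ∀ (G : Type) [Group G] [TopologicalSpace G] [IsTopologicalGroup G] [CompactSpace G]
    [MeasurableSpace G] [BorelSpace G] (r : LatticeRep G) (S : ℕ) [NeZero S] (β : ℝ), 0 < β →
    ∀ (i j : Fin 4), i ≠ j → ∀ (t : ℝ), 0 ≤ t → t < 1 →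
      ∫ U, Real.exp (t * β * ((r.N : ℝ) - plaquetteObs r.ρ 0 i j (torusLift S U)))
          ∂(wilsonMeasure r.ρ β : Measure (GaugeConfig 4 S G))
        ≤ ((1 - t)⁻¹) ^ (r.N ^ 2)

/-- **Lattice-scale moments** (card `scale-ladder-free-foot`, the FOOT): there are `β₀, C` such
that for every torus, every `β ≥ β₀`, every `n` and every `n`-tuple of plaquettes (positions `x`,
planes `q`, repetitions allowed) the centred plaquette energies in units of `1/β` have joint moments
`|E ∏ᵢ β(s_{pᵢ} − E s_{pᵢ})| ≤ Cⁿ nⁿ` (`≤ (Ce)ⁿ n!`). From `PlaquetteChiSqDomination` by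
`‖β(s_p − E s_p)‖_{Lⁿ} ≤ C n` (exponential moments) and Hölder. -/
def LatticeScaleMoments : Prop :=
  ∀ (G : Type) [Group G] [TopologicalSpace G] [IsTopologicalGroup G] [CompactSpace G]
    [MeasurableSpace G] [BorelSpace G] (r : LatticeRep G), ∃ (β₀ C : ℝ), ∀ (S : ℕ) [NeZero S]
    (β : ℝ), β₀ ≤ β → ∀ (n : ℕ) (x : Fin n → Literature.Probability.LatticeModels.Site 4)
    (q : Fin n → {q : Fin 4 × Fin 4 // q.1 < q.2}),
      |∫ U, ∏ i, (β * ((r.N : ℝ) - plaquetteObs r.ρ (x i) (q i).1.1 (q i).1.2 (torusLift S U))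
          - ∫ V, β * ((r.N : ℝ) - plaquetteObs r.ρ (x i) (q i).1.1 (q i).1.2 (torusLift S V))
              ∂(wilsonMeasure r.ρ β : Measure (GaugeConfig 4 S G)))
        ∂(wilsonMeasure r.ρ β : Measure (GaugeConfig 4 S G))|
        ≤ C ^ n * (n : ℝ) ^ n

/-- **Polynomially super-weak sub-crux** (card `polynomial-coupling-calibration`, First lemma):
the crux `ScalingWindowSplit.SelfNormalisedMomentBoundsR` with ONE extra hypothesis on the scheme,
`∀ᶠ k, (L_k : ℝ) ^ θ ≤ β_k`, inserted right after `sch.HasWeakCouplingLimit →`; otherwise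
character-identical. `θ`-monotone: `Poly θ → Poly θ'` for `θ ≤ θ'`; the crux is `∀`-stronger than
every `Poly θ` (`SelfNormalisedMomentBoundsR → Poly θ`, below). -/
def SelfNormalisedMomentBoundsPoly (θ : ℕ) : Prop :=
  open Literature.MathematicalPhysics.QuantumLattice Literature.MathematicalPhysics.AQFT Literature.MathematicalPhysics.QuantumFieldTheory in let E := EuclideanSpace ℝ (Fin 4); ∀ (G : Type) [Group G] [TopologicalSpace G] [IsTopologicalGroup G] [CompactSpace G] [MeasurableSpace G] [BorelSpace G] (r : LatticeRep G) (sch : SpeciesScheme (YMSpecies G)) (u : SchwartzMap E ℝ) (p : ℕ) (M : ℝ), let bare : SpeciesScheme (YMSpecies G) := { sch with c := fun _ _ => 1, m := fun _ _ => 0 }; let T : SchwartzMap E ℝ → ℕ → ℝ := fun w k => latticeSchwinger r.ρ bare (fun s => s.F) k (1 + 1) (fun _ => r.curvature) ![w, thetaTest 4 w] - latticeSchwinger r.ρ bare (fun s => s.F) k 1 (fun _ => r.curvature) ![w] * latticeSchwinger r.ρ bare (fun s => s.F) k 1 (fun _ => r.curvature) ![thetaTest 4 w]; let canon : SpeciesScheme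 (YMSpecies G) := { sch with c := fun _ k => (Real.sqrt (T u k))⁻¹, m := fun _ k => ∫ U, r.curvature.F (torusLift (sch.side k) U) ∂(wilsonMeasure r.ρ (sch.β k)) }; sch.HasWeakCouplingLimit → (∀ᶠ k in Filter.atTop, ((sch.L k : ℕ) : ℝ) ^ θ ≤ sch.β k) → (∃ N : ℕ, 1 ≤ N ∧ ∀ᶠ k in Filter.atTop, (sch.a k)⁻¹ ≤ (sch.a k * (sch.L k : ℝ)) ^ N) → tsupport u ⊆ {y : E | y 0 < 0} → (∀ᶠ k in Filter.atTop, (sch.a k) ^ p ≤ T u k ∧ T u k ≤ M * T (timeShiftTest 4 (-1) u) k) → ∃ (s : ℕ) (C₀ C₁ : ℝ), ∀ (n : ℕ) (F : Fin n → {q : Fin 4 × Fin 4 // q.1 < q.2} → SchwartzMap E ℝ), (∀ i, ∑ q, schwartzNorm s (ofRealTest (F i q)) ≤ 1) → (∀ i j, i ≠ j → ∀ q q', Disjoint (tsupport (F i q)) (tsupport (F j q'))) → ∀ k : ℕ, |∫ U, ∏ i, ∑ q : {q : Fin 4 × Fin 4 // q.1 < q.2}, smearedLatticeField (plaquetteObs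 r.ρ 0 q.1.1 q.1.2) (Literature.Probability.LatticeModels.box 4 (canon.L k)) (canon.a k) (canon.c r.curvature k) (canon.m r.curvature k / 6) (F i q) (torusLift (canon.side k) U) ∂(wilsonMeasure r.ρ (canon.β k) : Measure (GaugeConfig 4 (canon.side k) G))| ≤ C₀ * C₁ ^ n * n.factorial

/-- The crux implies each polynomial-regime sub-crux (one more hypothesis to discard). -/
theorem poly_of_crux (θ : ℕ)
    (h : Summit.QuantumFields.YangMills.Theses.ScalingWindowSplit.SelfNormalisedMomentBoundsR) :
    SelfNormalisedMomentBoundsPoly θ := by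
  intro G i1 i2 i3 i4 i5 i6 r sch u p M bare T canon hw hθ hpv hu hfw
  exact h G r sch u p M hw hpv hu hfw

end Summit.QuantumFields.YangMills.Cruxes.SelfNormalisedMomentBoundsR.Ideator1
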